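import Summits.RiemannHypothesis.RiemannHypothesis.Theorems.GroundBartaPolarPerronFrobeniusWindowImagePolarPrime
import Summits.RiemannHypothesis.RiemannHypothesis.Theorems.RuelleBandCofiniteCriticalLineStubBranchesContinuousAux
import Literature.NumberTheory.LFunctions.WeilExplicitRightEdge
import Literature.NumberTheory.LFunctions.WeilMellinInversion
import Literature.NumberTheory.LFunctions.WeilSmallSupportPositivity
import Literature.Analysis.SpecialFunctions.DigammaLogBound
import HarnessLib

/-!
# The window image of a test kernel is the Weil functional of its translates, II: archimedean term and assembly
(route `RiemannHypothesis/GroundBarta`, rung 3 `PolarPerronFrobenius`, stmt-RiemannHypothesis-18390 —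
theta-vector toolkit)

For Weil test functions `g, h` (smooth, compact support) the polarised Weil functional is an
`L²`-pairing of `g` against the TRANSLATE PROFILE of `h`:

  `W(g ⋆ h̃) = ∫ g(u) · conj( W(τ_u h) ) du`,   `(τ_u h)(t) = h(t + u)`,

(`weilFunctional_weilConv_weilReflect_eq_integral_translate`).  Term by term: the polar term of
`τ_u h` is `e^{u/2} ĥ(0) + e^{-u/2} ĥ(1)` and integrates against `g` to
`ĝ(0) conj ĥ(1) + ĝ(1) conj ĥ(0) = ((g ⋆ h̃)^(0) + (g ⋆ h̃)^(1))` (`weilMellin_weilConv`,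
`weilMellin_weilReflect`); the prime terms are finite sums and commute with `∫ g`; the archimedean
term (digamma form) is handled by Fubini on `(u, t) ↦ g(u) e^{itu} conj ĥ(½+it) Re ψ(¼+it/2)`,
integrable since `ĥ` decays like `(1+t²)^{-2}` on the critical line against the logarithmic growth
of `ψ`.  Consequently the window image `u ↦ W(τ_u h)` of a test kernel is an explicit continuous
function, and for Riemann's kernel `Φ` (all of whose translates are Weil-harmonic,
`phi_translate_harmonic`) the window image of the smooth theta window vector `Θ_a = Φχ_a` is
`u ↦ -W(τ_u κ_a)`, `κ_a` the collar tail (next file).  RH-free; elementary given the tree.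
References: Bombieri 2000 §§2–3 (transform calculus), Thm 2 (explicit formula, digamma form).
-/

set_option linter.dupNamespace false

noncomputable section

open Set MeasureTheory Filter Complex
open scoped Real Topology ComplexConjugate ArithmeticFunction.vonMangoldt

namespace Summit.RiemannHypothesis.RiemannHypothesis.Theorems.PolarPerronFrobenius

open Literature.NumberTheory.LFunctions
open Summit.RiemannHypothesis.RiemannHypothesis.Theorems.GroundStatesConvergeToXi

/-! ## The archimedean term (digamma form, Fubini) -/

/-- The digamma weight `t ↦ Re ψ(1/4 + it/2)` of `weilArchIntegral` is continuous with logarithmic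
growth, so `t ↦ ψ-weight · ĥ(1/2 + it)` is integrable for every test `h`. [folklore] -/
theorem wi_digammaWeight :
    Continuous (fun t : ℝ => ((Complex.digamma (1 / 4 + t / 2 * I)).re : ℂ)) ∧
      ∃ C : ℝ, ∀ t : ℝ, ‖((Complex.digamma (1 / 4 + t / 2 * I)).re : ℂ)‖ ≤ C + Real.log (1 + |t|) := by
  -- adapted from `ConnesVanSuijlekom.integrable_weilArchIntegrand` (Literature, private)
  obtain ⟨C, hC⟩ :=
    Literature.Analysis.SpecialFunctions.Complex.exists_norm_digamma_vertical_le
      (a := 1 / 4) (by norm_num)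
  have hw : ∀ t : ℝ, (1 / 4 : ℂ) + (t : ℂ) / 2 * I = ((1 / 4 : ℝ) : ℂ) + ((t / 2 : ℝ) : ℂ) * I := by
    intro t
    push_cast
    ring
  refine ⟨?_, C, fun t => ?_⟩
  · refine continuous_ofReal.comp (Complex.continuous_re.comp ?_)
    refine Literature.Analysis.SpecialFunctions.Complex.continuousOn_digamma.comp_continuous
      (by fun_prop) fun t => ?_
    rw [hw t]
    simp
  · have h1 : ‖((Complex.digamma (1 / 4 + t / 2 * I)).re : ℂ)‖ ≤
        ‖Complex.digamma (1 / 4 + t / 2 * I)‖ := by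
      simp only [Complex.norm_real, Real.norm_eq_abs]
      exact Complex.abs_re_le_norm _
    have h2 := hC (t / 2)
    rw [← hw t] at h2
    have h3 : Real.log (1 + |t / 2|) ≤ Real.log (1 + |t|) := by
      refine Real.log_le_log (by positivity) ?_
      rw [abs_div, abs_two]
      linarith [abs_nonneg t]
    linarith

/-- The archimedean integral of a translate: `archInt(τ_u h) = ∫ e^{-itu} ĥ(1/2+it) Re ψ dt`. [folklore] -/
theorem wi_weilArchIntegral_translate (h : ℝ → ℂ) (u : ℝ) :
    weilArchIntegral (fun t => h (t + u)) =
      ∫ t : ℝ, cexp (-(((t * u : ℝ) : ℂ) * I)) * weilMellin h (1 / 2 + t * I) *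
        ((Complex.digamma (1 / 4 + t / 2 * I)).re : ℂ) := by
  unfold weilArchIntegral
  congr 1 with t
  rw [wi_weilMellin_translate]
  congr 2
  push_cast
  ring

/-- Its conjugate: `conj archInt(τ_u h) = ∫ e^{itu} conj ĥ(1/2+it) Re ψ dt`. [folklore] -/
theorem wi_conj_weilArchIntegral_translate (h : ℝ → ℂ) (u : ℝ) :
    conj (weilArchIntegral (fun t => h (t + u))) =
      ∫ t : ℝ, cexp (((t * u : ℝ) : ℂ) * I) * conj (weilMellin h (1 / 2 + t * I)) *
        ((Complex.digamma (1 / 4 + t / 2 * I)).re : ℂ) := by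
  rw [wi_weilArchIntegral_translate, ← integral_conj]
  congr 1 with t
  rw [map_mul, map_mul, Complex.conj_ofReal, ← Complex.exp_conj, map_neg, map_mul,
    Complex.conj_ofReal, Complex.conj_I]
  congr 2
  ring

/-- **Archimedean part of the translate identity** (integral form):
`∫ g(u) conj(archInt(τ_u h)) du = archInt(g ⋆ h̃)`, together with the integrability of the
integrand (Fubini on `(u,t) ↦ g(u) e^{itu} conj ĥ(1/2+it) Re ψ(1/4+it/2)`). [folklore] -/
theorem wi_archIntegral {g h : ℝ → ℂ} (hg : IsWeilTest g) (hh : IsWeilTest h) :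
    Integrable (fun u : ℝ => g u * conj (weilArchIntegral (fun t => h (t + u)))) ∧
      ∫ u, g u * conj (weilArchIntegral (fun t => h (t + u))) =
        weilArchIntegral (weilConv g (weilReflect h)) := by
  obtain ⟨hFc, C, hFb⟩ := wi_digammaWeight
  set ψF : ℝ → ℂ := fun t => ((Complex.digamma (1 / 4 + t / 2 * I)).re : ℂ) with hψF
  -- the Fubini kernel
  set G : ℝ → ℝ → ℂ := fun u t =>
    g u * (cexp (((t * u : ℝ) : ℂ) * I) * conj (weilMellin h (1 / 2 + t * I)) * ψF t) with hG
  have hgi : Integrable g := hg.1.continuous.integrable_of_hasCompactSupport hg.2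
  have hI : Integrable fun t : ℝ => weilMellin h (1 / 2 + t * I) * ψF t :=
    RuelleBandCofiniteCriticalLine.stub_branchesContinuous_integrable_weilArchIntegrand hh
  have hMc : Continuous fun t : ℝ => weilMellin h (1 / 2 + t * I) := by
    have h1 := continuous_weilMellin_vertical hh.1.continuous hh.2 (1 / 2)
    refine h1.congr fun t => ?_
    push_cast
    ring_nf
  have hGc : Continuous (Function.uncurry G) := by
    have h1 : Continuous fun p : ℝ × ℝ => g p.1 := hg.1.continuous.comp continuous_fst
    have h2 : Continuous fun p : ℝ × ℝ => cexp (((p.2 * p.1 : ℝ) : ℂ) * I) := by fun_prop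
    have h3 : Continuous fun p : ℝ × ℝ => conj (weilMellin h (1 / 2 + p.2 * I)) :=
      Complex.continuous_conj.comp (hMc.comp continuous_snd)
    have h4 : Continuous fun p : ℝ × ℝ => ψF p.2 := hFc.comp continuous_snd
    exact h1.mul ((h2.mul h3).mul h4)
  have hGi : Integrable (Function.uncurry G) ((volume : Measure ℝ).prod volume) := by
    refine Integrable.mono' (hgi.norm.mul_prod hI.norm) hGc.aestronglyMeasurable
      (Eventually.of_forall ?_)
    rintro ⟨u, t⟩
    simp only [Function.uncurry_apply_pair, hG]
    rw [norm_mul, norm_mul, norm_mul, norm_mul, Complex.norm_exp_ofReal_mul_I, one_mul,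
      Complex.norm_conj]
  -- inner integrals
  have hleft : ∀ u : ℝ, ∫ t, G u t = g u * conj (weilArchIntegral (fun t => h (t + u))) := by
    intro u
    simp only [hG]
    rw [integral_const_mul, wi_conj_weilArchIntegral_translate]
  have hright : ∀ t : ℝ, ∫ u, G u t =
      weilMellin (weilConv g (weilReflect h)) (1 / 2 + t * I) * ψF t := by
    intro t
    have e1 : (fun u => G u t) = fun u => (g u * cexp (((t * u : ℝ) : ℂ) * I)) *
        (conj (weilMellin h (1 / 2 + t * I)) * ψF t) := by
      funext u; simp only [hG]; ring
    rw [e1, integral_mul_const]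
    have e2 : ∫ u, g u * cexp (((t * u : ℝ) : ℂ) * I) = weilMellin g (1 / 2 + t * I) := by
      unfold weilMellin
      congr 1 with u
      congr 1
      push_cast
      ring_nf
    rw [e2, weilMellin_weilConv_holds hg.1.continuous hg.2 hh.weilReflect.1.continuous
      hh.weilReflect.2, weilMellin_weilReflect_holds]
    have e3 : (1 : ℂ) - conj (1 / 2 + (t : ℂ) * I) = 1 / 2 + t * I := by
      rw [map_add, map_mul, Complex.conj_ofReal, Complex.conj_I, map_div₀, map_one, map_ofNat]
      ring
    rw [e3]
    ring
  refine ⟨?_, ?_⟩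
  · exact (hGi.integral_prod_left).congr (Eventually.of_forall hleft)
  · have hswap := integral_integral_swap hGi
    simp only [hleft, hright] at hswap
    rw [hswap]
    rfl

/-- **Archimedean part of the translate identity**: `∫ g(u) conj(arch(τ_u h)) du = arch(g ⋆ h̃)`
(digamma form `arch k = (1/2π) archInt k − k(0) log π`). [folklore] -/
theorem wi_arch {g h : ℝ → ℂ} (hg : IsWeilTest g) (hh : IsWeilTest h) :
    Integrable (fun u : ℝ => g u * conj (weilArchTerm (fun t => h (t + u)))) ∧
      ∫ u, g u * conj (weilArchTerm (fun t => h (t + u))) = weilArchTerm (weilConv g (weilReflect h)) := by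
  obtain ⟨hAi, hA⟩ := wi_archIntegral hg hh
  have hhi : Integrable fun u : ℝ => g u * conj (h u) :=
    (hg.1.continuous.mul (Complex.continuous_conj.comp hh.1.continuous)).integrable_of_hasCompactSupport
      hg.2.mul_right
  have hpt : ∀ u : ℝ, g u * conj (weilArchTerm (fun t => h (t + u))) =
      (1 / (2 * π) : ℂ) * (g u * conj (weilArchIntegral (fun t => h (t + u)))) -
        (Real.log π : ℂ) * (g u * conj (h u)) := by
    intro u
    rw [weilArchTerm, map_sub, map_mul, map_mul, zero_add, Complex.conj_ofReal, map_div₀, map_one,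
      map_mul, map_ofNat, Complex.conj_ofReal]
    ring
  have hint : Integrable fun u : ℝ => g u * conj (weilArchTerm (fun t => h (t + u))) := by
    have h1 := (hAi.const_mul (1 / (2 * π) : ℂ)).sub (hhi.const_mul (Real.log π : ℂ))
    exact h1.congr (Eventually.of_forall fun u => (hpt u).symm)
  refine ⟨hint, ?_⟩
  simp_rw [hpt]
  rw [integral_sub (hAi.const_mul _) (hhi.const_mul _), integral_const_mul, integral_const_mul, hA,
    weilArchTerm]
  have e0 : weilConv g (weilReflect h) 0 = ∫ u, g u * conj (h u) := by
    rw [weilConv_weilReflect_apply_eq_integral_mul_conj]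
    simp only [sub_zero]
  rw [e0]
  ring

/-! ## The translate identity -/

/-- **The window image of a test kernel is the Weil functional of its translates**: for Weil tests
`g, h`,  `W(g ⋆ h̃) = ∫ g(u) · conj( W(h(· + u)) ) du`.  [cite: Bombieri2000Weil, Thm 2 and §§2–3] -/
theorem weilFunctional_weilConv_weilReflect_eq_integral_translate {g h : ℝ → ℂ} (hg : IsWeilTest g)
    (hh : IsWeilTest h) :
    weilFunctional (weilConv g (weilReflect h)) =
      ∫ u, g u * conj (weilFunctional (fun t => h (t + u))) := by
  obtain ⟨hAi, hA⟩ := wi_arch hg hh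
  -- integrability of the polar and prime pieces
  have hPi : Integrable fun u : ℝ => g u * conj (weilPolarTerm (fun t => h (t + u))) := by
    have hc : Continuous fun u : ℝ => conj (weilPolarTerm (fun t => h (t + u))) := by
      have e : (fun u : ℝ => conj (weilPolarTerm (fun t => h (t + u)))) = fun u : ℝ =>
          conj (cexp ((u : ℂ) / 2) * weilMellin h 0 + cexp (-((u : ℂ) / 2)) * weilMellin h 1) :=
        funext fun u => by rw [wi_weilPolarTerm_translate]
      rw [e]
      fun_prop
    exact (hg.1.continuous.mul hc).integrable_of_hasCompactSupport hg.2.mul_right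
  have hPri : Integrable fun u : ℝ => g u * conj (weilPrimeTerm (fun t => h (t + u))) := by
    -- the prime piece agrees with a finite sum of continuous compactly supported functions
    obtain ⟨Rg, hRg0, hRg⟩ := wi_exists_radius hg.2
    obtain ⟨Rh, hRh0, hRh⟩ := wi_exists_radius hh.2
    set N : ℕ := ⌈Real.exp (Rg + Rh + 1)⌉₊ with hN
    set S : Finset ℕ := Finset.range N with hS
    have hlog : ∀ n, n ∉ S → Rg + Rh + 1 ≤ Real.log n := by
      intro n hn
      rw [hS, Finset.mem_range, not_lt] at hn
      have hn' : Real.exp (Rg + Rh + 1) ≤ n := (Nat.le_ceil _).trans (by exact_mod_cast hn)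
      have hpos : (0 : ℝ) < n := (Real.exp_pos _).trans_le hn'
      rwa [Real.le_log_iff_exp_le hpos]
    have hfin : ∀ u : ℝ, g u * conj (weilPrimeTerm (fun t => h (t + u))) =
        g u * conj (∑ n ∈ S, ((Λ n : ℝ) : ℂ) / (Real.sqrt n : ℂ) *
          (h (Real.log n + u) + h (-Real.log n + u))) := by
      intro u
      by_cases hgu : g u = 0
      · simp [hgu]
      · congr 2
        unfold weilPrimeTerm
        refine tsum_eq_sum fun n hn => ?_
        have hl := hlog n hn
        have hu := abs_le.1 (hRg u hgu)
        have e1 : h (Real.log n + u) = 0 := by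
          by_contra hne
          have h1 := abs_le.1 (hRh _ hne)
          linarith [h1.2]
        have e2 : h (-Real.log n + u) = 0 := by
          by_contra hne
          have h1 := abs_le.1 (hRh _ hne)
          linarith [h1.1]
        simp only [e1, e2, add_zero, mul_zero]
    have hc : Continuous fun u : ℝ => conj (∑ n ∈ S, ((Λ n : ℝ) : ℂ) / (Real.sqrt n : ℂ) *
        (h (Real.log n + u) + h (-Real.log n + u))) := by
      refine Complex.continuous_conj.comp (continuous_finsetSum _ fun n _ => ?_)
      have h1 : Continuous fun u : ℝ => h (Real.log n + u) :=
        hh.1.continuous.comp (continuous_const.add continuous_id)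
      have h2 : Continuous fun u : ℝ => h (-Real.log n + u) :=
        hh.1.continuous.comp (continuous_const.add continuous_id)
      exact continuous_const.mul (h1.add h2)
    exact ((hg.1.continuous.mul hc).integrable_of_hasCompactSupport hg.2.mul_right).congr
      (Eventually.of_forall fun u => (hfin u).symm)
  -- split `W = polar − prime + arch` on both sides
  have hsplit : ∀ u : ℝ, g u * conj (weilFunctional (fun t => h (t + u))) =
      g u * conj (weilPolarTerm (fun t => h (t + u))) -
        g u * conj (weilPrimeTerm (fun t => h (t + u))) +
        g u * conj (weilArchTerm (fun t => h (t + u))) := by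
    intro u
    rw [weilFunctional, map_add, map_sub]
    ring
  have hPPi : Integrable fun u : ℝ => g u * conj (weilPolarTerm (fun t => h (t + u))) -
      g u * conj (weilPrimeTerm (fun t => h (t + u))) := hPi.sub hPri
  simp_rw [hsplit]
  rw [integral_add hPPi hAi, integral_sub hPi hPri, wi_polar hg hh, wi_prime hg hh, hA,
    weilFunctional]

end Summit.RiemannHypothesis.RiemannHypothesis.Theorems.PolarPerronFrobenius

end
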